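import Summits.QuantumFields.YangMills.Theorems.BalabanUVNodesN16H7LooseOfReg910SlotFamily
import Summits.QuantumFields.YangMills.Theorems.BalabanUVNodesN16H5OfLettersB9SrcAllTorusPinned
import HarnessLib

/-!
# Route «BalabanUVNodes», crux K3⁷ `SpineGivenEndpointR13SepCoPH` (stmt-QuantumFields-20544) — node N16 = NE3, edges N05∕N07 → N16, LETTERS currency:
# THE (β16) LOOSE ROAD's PER-FAMILY PRODUCERS FROM [Balaban1985BackgroundPropagators]'s FOUR LETTERS, RE-KEYED AT THE SLOT CUBES
# (`hT : ∀ k, Thm1At C (torusVP …)` — refuted at rank two by `…N16Thm1AtTorusVPSmallCubes` — replaced by dag-n16-w1's slot key `hR`)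

Cell `pub-ymgap`, seat `pub-ymgap-dag-n16-w2` (WIDTH SEAT 2∕3 on node N16), generation g4, file 5 = the slot-keyed TWIN of this seat's g3 file
`…N16LettersOfLettersB9SrcAllTorus` (p603607) §3.  `--kind proof --supports stmt-QuantumFields-20544 --as helper` (count-neutral).  THEOREMS ONLY (0 `def`, 0 `sorry`,
standard axioms); one application each of dag-n16-w1 g5's `…N16H7LooseOfReg910SlotFamily.exists_letters_…_of_h5_reg910Slot` at `h5 := h5_of_lettersB9Src_allTorusPinned …`
(this seat's g3 file 1, p601904); nothing of anyone's re-declared.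

WHY.  The g3 producers `exists_letters_inEndRegimeH_leafSlotHolderAT_of_lettersB9Src_thm1At` ∕ `exists_letters_n16HolderAt_looseSub_of_lettersB9Src_thm1At` display the binder
bundle `(hGm, hG, hM, hT : ∀ k, Thm1At C (torusVP 4 F.L Nper G (k+1)))`, which `N16Thm1AtTorusVPSmallCubes.not_stub_thm1At` proves UNINHABITED at `N = 2` (leaf-06's all-cube reading
D-s3-3): those two theorems are vacuous as typed there.  The repaired N07 in-edge of the loose road is dag-n16-w1 g5's SLOT KEY (T9ˢ)
`hR : ∀ k ε₁, 0 < ε₁ → ε₁ ≤ C.a₁ → ∀ V U, V ∈ sfClass 4 F.L Nper ε₁ 0 → IsMinimiser 4 (sfClass 4 F.L Nper (C.B₃ε₁)) F.L Nper (k+1) V U → ∀ x, B11.Regularity (torusVP 4 F.L Nper G (k+1)) C.B₃ C.B₄ ε₁ U (x, F.L^(k+1) − 1 + F.L^(k+1) + 2)`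
((9)–(10) at the ONE cube the road reads; NOT refuted by the small-cube witness; NO `hM`, NO `hT`).  THIS FILE: the same two producers (and the const-road node statement) with
`(hGm, hG, C, hR)` in place of `(hGm, hG, C, hM, hT)`, in the LETTERS currency — so under K3⁷ v5's loose pin family `F`'s N16 conjunct costs [4]'s four letters at the pinned members
(N06) and Theorem 1's (9)–(10) AT THE SLOT CUBES of leaf-06's torus instances (N07).

HONEST FRAMING.  By-name assembly; every in-edge (the four letters; the slot key) is a DISPLAYED hypothesis asserted for no family; nothing of Bałaban asserted or refuted; no stub of
K3⁷ v5 named; N16 ∕ N05 ∕ N06 ∕ N07 NOT discharged; counts UNMOVED (typed 28∕28 · discharged 5∕27 · A 5∕28); one finite 𝕋⁴ programme at fixed ε — R4 closes the conditional finite-𝕋⁴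
rung `BalabanLadder.UV` only; the YM mass gap (Clay) is NOT proved by any of this; nothing continuum ∕ ℝ⁴ ∕ OS.
-/

set_option autoImplicit false

open scoped BigOperators Matrix Matrix.Norms.L2Operator
open NormedSpace

namespace Summit.QuantumFields.YangMills.BalabanUVNodes.N16LettersOfLettersB9SrcAllTorusSlot

open Literature.MathematicalPhysics.QuantumFieldTheory.Balaban1983to89
open Literature.MathematicalPhysics.QuantumFieldTheory.Balaban1983to89.T4Continuum (T4Family)
open B7Prop1Explicit B7Prop2Explicit MatrixLog UnitaryModel
open T4AveragingDeficitWall hiding Site Plane Plaq Bond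
open Summit.QuantumFields.BalabanUV.T4Continuum
open B7Prop3Flat (c3) open B7Prop1Local (InBox)
open B8LeafModelZd (ZdIdx)
open B8LeafModelZd3 (zdGF3 SockB9P3)
open B8TowerBondsPrinted (towerBondsP)
open B8SockLettersRD (SockLettersRD)
open B8Lemma1NonAbelian (mulCfg)
open B8LanF146 (LanF146)
open B8Eq138LandauZd (covLap QT InR138)
open B7Eq92Concrete (mgauge)
open B8Ineq130 (tlo thi) open B8Ineq132 (InAk covDerivFwd) open B7Eq78Linearization (zdBlocking QprimeIter)
open B8Eq119TwistedAxial (bgT Restr129 InAx) open B8Eq140Level (SideTouches) open B8Eq1117Concrete (XSpace) open B8Prop5ContractionKLevel (Bd2)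
open B8LambdaSpaceKLevel (wt) open B8Eq184Proof (cfgExp) open B8Eq146AExpansion (iEta) open B7Prop4GeneralLevels (linCovIter)
open B8Eq155JBound (Jcur wsup) open B8ScaledSupNorm (bondNorm msup Bdd)
open Node00 (NE3Letters₁₁ ne3ConstLayerOfRecord₁₁ ne3NperOfRecord₁₁ ne3DomOfRecord₁₁ MatA)
open NE3.LeafIndexSockets (LeafH3sup)
open MinimalActionSandwich (IsMinimiser)
open MinimalActionRate (sfClass)
open MinimalActionDictionary (torusVP RadiiMono)
open AveragingDeficitLatticeH2Prep (fd)
open B11 (Regularity)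
open YMDAG.UVSplit (ne3OfRecord₁₁)
open Summit.QuantumFields.YangMills.BalabanUVNodes.N16HolderDefs (N16HolderAt)
open Summit.QuantumFields.YangMills.BalabanUVNodes.N16HolderRegime (InEndRegimeH radiusOfRecordH constOfRecordH)
open Summit.QuantumFields.YangMills.BalabanUVNodes.N16LeafSlotAllTorus (LeafSlotHolderAT)
open Summit.QuantumFields.YangMills.BalabanUVNodes.N16H7LooseOfReg910SlotFamily (exists_letters_inEndRegimeH_leafSlotHolderAT_of_h5_reg910Slot
  exists_letters_n16HolderAt_loose_of_h5_reg910Slot exists_letters_n16HolderAt_looseSub_of_h5_reg910Slot)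
open Summit.QuantumFields.YangMills.BalabanUVNodes.N16H5OfLettersB9SrcAllTorusPinned (h5_of_lettersB9Src_allTorusPinned)

noncomputable section

variable {N : ℕ} [NeZero N]

section PerFamily

/-! ### Shared hypotheses (section variables, included in every theorem below, in this order): the family `F`, a coupling letter `g > 0`, the exponent `β` and
length letter `len` with N16's two lines, the input record `inp`, `C₂`, `B₀(β₀)`, the constants under node N05's D9b guards, and [Balaban1985BackgroundPropagators]'s FOUR
LETTERS `SLet ∕ SLetUB ∕ SB9P ∕ SH59src` AT THE PINNED ALL-TORUS MEMBERS of `(M_N ℂ, 4, F.L)` ONLY (file 1's binders at `L := F.L`, each under the lineage's `letI`) -/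

variable (F : T4Family) {g : ℝ} (hg : 0 < g) (β : ℝ) {len : Site 4 → ℝ}
    (hlen : ∀ v : Site 4, 0 < len v → 1 ≤ len v) (hlen1 : ∀ μ : Fin 4, len (e μ) = 1)
    (inp : B8.B9Inputs) {B₀β C₂ : ℝ} (hB₀β : 0 ≤ B₀β) (hC₂eq : C₂ = 2097152 * (((4 : ℕ) : ℝ) + 1) ^ 2 * (F.L : ℝ) ^ 2)
    {cB9 B₀'H B₂' BG BR cL c59 γ₈ γ' B₈ : ℝ}
    (hcB9 : 0 < cB9) (hB₀'H : 0 < B₀'H) (hB₂' : 0 ≤ B₂') (hBG : 0 ≤ BG) (hBR : 0 ≤ BR) (hcL : 0 < cL) (hc59 : 0 < c59) (hγ₈ : 1 ≤ γ₈) (hγ' : 0 ≤ γ')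
    (hB : 2 ≤ 5 * ((4 : ℕ) : ℝ) * F.L * inp.B₀) (hB₀8 : inp.B₀ ≤ B₈)
    (hγB : 5 * ((4 : ℕ) : ℝ) * F.L * inp.B₀ + 2 * (γ' * inp.B₀) ≤ 5 * ((4 : ℕ) : ℝ) * F.L * B₈)
    (hfreeS : 3 * (2 * ((4 : ℕ) : ℝ) * (F.L : ℝ) ^ 2) * BG * BR * (B₈ + γ₈) ≤ inp.B₀' * B₈)
    (SLet : letI : CStarAlgebra (Matrix (Fin N) (Fin N) ℂ) := {}
      ∀ i : {i : ZdIdx 4 F.L // (∀ j, i.Ω j = Set.univ) ∧ (∀ m j, i.Λs m j = {_y | j = m}) ∧ (∀ m j, i.Λb m j = {_c | j = m}) ∧ i.η = ((F.L : ℝ)⁻¹) ^ i.k},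
      SockLettersRD (𝔸 := Matrix (Fin N) (Fin N) ℂ) F.L BG BR B₀'H B₂' cL i.1.η i.1.k i.1.Ω i.1.Λs)
    (SLetUB : letI : CStarAlgebra (Matrix (Fin N) (Fin N) ℂ) := {}
      ∀ i : {i : ZdIdx 4 F.L // (∀ j, i.Ω j = Set.univ) ∧ (∀ m j, i.Λs m j = {_y | j = m}) ∧ (∀ m j, i.Λb m j = {_c | j = m}) ∧ i.η = ((F.L : ℝ)⁻¹) ^ i.k},
      ∀ α₀ : ℝ, 0 < α₀ → α₀ ≤ cL → ∀ U₀ : Site 4 → Fin 4 → (Matrix (Fin N) (Fin N) ℂ)ˣ, (∀ x κ, U₀ x κ ∈ unitaryUnits (Matrix (Fin N) (Fin N) ℂ)) →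
      InAk F.L i.1.k i.1.η α₀ i.1.Ω U₀ →
      ∃ (g Δ : (Site 4 → Matrix (Fin N) (Fin N) ℂ) →ₗ[ℂ] (Site 4 → Matrix (Fin N) (Fin N) ℂ)) (q : (Site 4 → Matrix (Fin N) (Fin N) ℂ) →ₗ[ℂ] (ℕ → Site 4 → Matrix (Fin N) (Fin N) ℂ))
        (qs : (ℕ → Site 4 → Matrix (Fin N) (Fin N) ℂ) →ₗ[ℂ] (Site 4 → Matrix (Fin N) (Fin N) ℂ)) (Aw c : (ℕ → Site 4 → Matrix (Fin N) (Fin N) ℂ) →ₗ[ℂ] (ℕ → Site 4 → Matrix (Fin N) (Fin N) ℂ))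
        (H' : XSpace 4 i.1.k (Matrix (Fin N) (Fin N) ℂ) →ₗ[ℂ] (Site 4 → Matrix (Fin N) (Fin N) ℂ)),
        (∀ x : Site 4 → Matrix (Fin N) (Fin N) ℂ, (∃ C : ℝ, ∀ y, ‖x y‖ ≤ C) → g (Δ x + qs (Aw (q x))) = x) ∧ (∀ φ, qs (c (q (g (g (qs φ))))) = qs φ) ∧
        (∀ (f : Site 4 → Matrix (Fin N) (Fin N) ℂ), ∀ x ∈ i.1.Ω 0, Δ f x = covLap i.1.η U₀ ((i.1.Ω 0).indicator f) x) ∧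
        (∀ (μ : ℕ → Site 4 → Matrix (Fin N) (Fin N) ℂ), ∀ x ∈ i.1.Ω 0, qs μ x = QT F.L i.1.k (i.1.Λs i.1.k) U₀ μ x) ∧
        (∀ (f : Site 4 → Matrix (Fin N) (Fin N) ℂ) (n : ℕ), n ≤ i.1.k → ∀ y ∈ i.1.Λs i.1.k n, q f n y = QprimeIter (zdBlocking 4 F.L) (bgT F.L U₀) n f y) ∧
        (∀ (f : Site 4 → Matrix (Fin N) (Fin N) ℂ) (n : ℕ) (y : Site 4), ¬ (n ≤ i.1.k ∧ y ∈ i.1.Λs i.1.k n) → q f n y = 0) ∧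
        (∀ (X : XSpace 4 i.1.k (Matrix (Fin N) (Fin N) ℂ)) (x : Site 4), ‖H' X x‖ ≤ B₀'H * ‖X‖) ∧
        (∀ n, n ≤ i.1.k → ∀ (X : XSpace 4 i.1.k (Matrix (Fin N) (Fin N) ℂ)), ∀ p ∈ {b : Site 4 × Fin 4 | SideTouches (i.1.Ω n) b.1 b.2},
          wt F.L i.1.η n * ‖covDerivFwd i.1.η U₀ p.2 (H' X) p.1‖ ≤ B₀'H * ‖X‖) ∧
        (∀ X : XSpace 4 i.1.k (Matrix (Fin N) (Fin N) ℂ), Bd2 F.L i.1.η i.1.k i.1.Ω (covLap i.1.η U₀ (H' X)) (B₂' * ‖X‖)) ∧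
        (∀ (Y : XSpace 4 i.1.k (Matrix (Fin N) (Fin N) ℂ)) (n : ℕ) (hn : n ≤ i.1.k) (y : Site 4), y ∈ i.1.Λs i.1.k n →
          QprimeIter (zdBlocking 4 F.L) (bgT F.L U₀) n (H' Y) y = Y (⟨n, Nat.lt_succ_of_le hn⟩, y)) ∧
        (∀ (f : Site 4 → Matrix (Fin N) (Fin N) ℂ) (r : ℝ), 0 ≤ r → Bd2 F.L i.1.η i.1.k i.1.Ω f r →
          (∀ x, ‖g f x‖ ≤ BG * r) ∧ ∀ n, n ≤ i.1.k → ∀ p ∈ {b : Site 4 × Fin 4 | SideTouches (i.1.Ω n) b.1 b.2},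
            wt F.L i.1.η n * ‖covDerivFwd i.1.η U₀ p.2 (g f) p.1‖ ≤ BG * r) ∧
        (∀ (f : Site 4 → Matrix (Fin N) (Fin N) ℂ) (r : ℝ), 0 ≤ r → Bd2 F.L i.1.η i.1.k i.1.Ω f r → Bd2 F.L i.1.η i.1.k i.1.Ω (f - g (qs (c (q (g f))))) (BR * r)))
    (SB9P : letI : CStarAlgebra (Matrix (Fin N) (Fin N) ℂ) := {}
      ∀ i : {i : ZdIdx 4 F.L // (∀ j, i.Ω j = Set.univ) ∧ (∀ m j, i.Λs m j = {_y | j = m}) ∧ (∀ m j, i.Λb m j = {_c | j = m}) ∧ i.η = ((F.L : ℝ)⁻¹) ^ i.k},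
      SockB9P3 (𝔸 := Matrix (Fin N) (Fin N) ℂ) F.L inp.B₀ B₀β cB9 β len i.1.η i.1.k i.1.Ω i.1.Λs (fun m j => towerBondsP F.L i.1.Ω (i.1.Λs m) j))
    (SH59src : letI : CStarAlgebra (Matrix (Fin N) (Fin N) ℂ) := {}
      ∀ i : {i : ZdIdx 4 F.L // (∀ j, i.Ω j = Set.univ) ∧ (∀ m j, i.Λs m j = {_y | j = m}) ∧ (∀ m j, i.Λb m j = {_c | j = m}) ∧ i.η = ((F.L : ℝ)⁻¹) ^ i.k},
      ∀ α₀ α₁ : ℝ, 0 < α₀ → 0 < α₁ → α₀ + α₁ ≤ c59 →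
      ∀ U₀ U' : Site 4 → Fin 4 → (Matrix (Fin N) (Fin N) ℂ)ˣ, (∀ x κ, U₀ x κ ∈ unitaryUnits (Matrix (Fin N) (Fin N) ℂ)) → (∀ x κ, U' x κ ∈ unitaryUnits (Matrix (Fin N) (Fin N) ℂ)) →
      ∀ φ : Site 4 → Matrix (Fin N) (Fin N) ℂ, ((InR138 F.L i.1.k i.1.η (i.1.Ω 0) (i.1.Λs i.1.k) U₀ φ ∧ (∀ x, IsSelfAdjoint (φ x)) ∧ (∀ x, x ∉ i.1.Ω 0 → φ x = 0) ∧
          Bdd F.L i.1.k i.1.η (-(2 : ℝ)) (fun j (x : Site 4) => x ∈ i.1.Ω j) φ) ∧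
        msup F.L i.1.k i.1.η (-(2 : ℝ)) (fun j (x : Site 4) => x ∈ i.1.Ω j) φ < γ₈ * (α₀ + α₁)) →
      InAk F.L i.1.k i.1.η α₀ i.1.Ω U₀ → InAk F.L i.1.k i.1.η α₀ i.1.Ω (mulCfg U' U₀) → (∀ m, m ≤ i.1.k → InAx F.L m (i.1.Λs m) U₀ (mulCfg U' U₀)) →
      (∀ j, j ≤ i.1.k → ∀ (z : Site 4) (μ : Fin 4),
        ((∀ x, InBox (tlo F.L z j) (thi F.L z j) x → x ∈ i.1.Ω j) ∨ (∀ x, InBox (tlo F.L (z + e μ) j) (thi F.L (z + e μ) j) x → x ∈ i.1.Ω j)) →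
        ‖(avgIter F.L (mulCfg U' U₀) j z μ : Matrix (Fin N) (Fin N) ℂ) - (avgIter F.L U₀ j z μ : Matrix (Fin N) (Fin N) ℂ)‖ ≤ α₁) →
      (∀ b ∈ {b : Site 4 × Fin 4 | SideTouches (i.1.Ω 0) b.1 b.2}, ‖((U' b.1 b.2 : (Matrix (Fin N) (Fin N) ℂ)ˣ) : Matrix (Fin N) (Fin N) ℂ) - 1‖ ≤ α₁) →
      (∀ m, 1 ≤ m → m ≤ i.1.k → ∀ (u : Site 4 → (Matrix (Fin N) (Fin N) ℂ)ˣ) (W : Site 4 → Fin 4 → (Matrix (Fin N) (Fin N) ℂ)ˣ) (A' : Site 4 → Fin 4 → Matrix (Fin N) (Fin N) ℂ),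
        (∀ x, u x ∈ unitaryUnits (Matrix (Fin N) (Fin N) ℂ)) → mgauge U₀ u W = U' → Restr129 F.L m (i.1.Λs m) U₀ u → LanF146 F.L i.1.k i.1.η (i.1.Ω 0) i.1.Λs U₀ φ m W →
        (∀ y τ, IsSelfAdjoint (A' y τ)) →
        (∀ j, j ≤ m → ∀ y τ, SideTouches (i.1.Ω j) y τ →
        W y τ = cfgExp i.1.η A' y τ ∧ ‖A' y τ‖ ≤ (2 * (F.L * (5 * ((4 : ℕ) : ℝ) * F.L * B₈ * (α₀ + α₁))) + 8 * (8 * inp.B₀' * (5 * ((4 : ℕ) : ℝ) * F.L * B₈) * (α₀ + α₁))) * ((F.L : ℝ) ^ j * i.1.η)⁻¹) →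
        (∀ y τ, (∀ j, j ≤ m → ¬ SideTouches (i.1.Ω j) y τ) → A' y τ = 0) →
        msup F.L m i.1.η (-(1 : ℝ)) (fun j (b : Site 4 × Fin 4) => SideTouches (i.1.Ω j) b.1 b.2) (fun b => A' b.1 b.2)
        ≤ inp.B₀ * (bondNorm F.L m i.1.η (-(3 : ℝ)) i.1.Ω (fun x μ => Jcur i.1.η U₀ A' μ x)
        + wsup 1 (fun p : {p : ℕ × (Site 4 × Fin 4) // p.1 ≤ m ∧ p.2 ∈ towerBondsP F.L i.1.Ω (i.1.Λs m) p.1} =>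
        linCovIter F.L U₀ (iEta i.1.η A') p.1.1 p.1.2.1 p.1.2.2)) + γ' * inp.B₀ * (α₀ + α₁) ∧
        msup F.L m i.1.η (-(2 : ℝ)) (fun j (t : Fin 4 × Fin 4 × Site 4) => SideTouches (i.1.Ω j) t.2.2 t.2.1)
        (fun t => covDerivFwd i.1.η U₀ t.1 (fun z => A' z t.2.1) t.2.2)
        ≤ inp.B₀ * (bondNorm F.L m i.1.η (-(3 : ℝ)) i.1.Ω (fun x μ => Jcur i.1.η U₀ A' μ x)
        + wsup 1 (fun p : {p : ℕ × (Site 4 × Fin 4) // p.1 ≤ m ∧ p.2 ∈ towerBondsP F.L i.1.Ω (i.1.Λs m) p.1} =>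
        linCovIter F.L U₀ (iEta i.1.η A') p.1.1 p.1.2.1 p.1.2.2)) + γ' * inp.B₀ * (α₀ + α₁)))

include hg hlen hlen1 hB₀β hC₂eq hcB9 hB₀'H hB₂' hBG hBR hcL hc59 hγ₈ hγ' hB hB₀8 hγB hfreeS SLet SLetUB SB9P SH59src


/-! ## The three per-family producers at the slot key, letters currency -/

/-- **PER FAMILY: LETTERS ⟹ THE CONST-LAYER CLOSER INPUTS ON THE LOOSE-DATA CARRIER, SLOT KEY** — `exists_letters_inEndRegimeH_leafSlotHolderAT_of_lettersB9Src_thm1At`'s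
conclusion VERBATIM from the four letters (section hypotheses), `(hGm, hG, C)` and dag-n16-w1's slot key `hR` (NO `hM`, NO `hT`): one application of
`N16H7LooseOfReg910SlotFamily.exists_letters_inEndRegimeH_leafSlotHolderAT_of_h5_reg910Slot` at `h5 := h5_of_lettersB9Src_allTorusPinned …`.
[cite: Balaban1985Variational, Thm 1 (9)–(10) p.279; Balaban1985RegularSpaces, Thm 4 p.88, Prop. 3 p.87; Balaban1985BackgroundPropagators, Thm 3.3 p.398] [folklore] -/
theorem exists_letters_inEndRegimeH_leafSlotHolderAT_of_lettersB9Src_reg910Slot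
    {G : (Site 4 → Fin 4 → (MatA N)ˣ) → Site 4 → ℕ → ℝ → ℝ → ℝ → Prop} (hGm : RadiiMono 4 G)
    (hG : ∀ (U : Site 4 → Fin 4 → (MatA N)ˣ) (x : Site 4) (K : ℕ) (α₀ α₁ α₂ : ℝ), 2 ≤ K → G U x K α₀ α₁ α₂ →
      ∃ (u : Site 4 → (MatA N)ˣ) (a : Site 4 → Fin 4 → MatA N),
        (∀ z, u z ∈ unitaryUnits (MatA N)) ∧
        (∀ (y : Site 4) (τ : Fin 4), l1 (y - x) ≤ 2 → ((gaugeAct u U y τ : (MatA N)ˣ) : MatA N) = exp (a y τ)) ∧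
        (∀ (y : Site 4) (τ : Fin 4), l1 (y - x) ≤ 2 → ‖a y τ‖ ≤ α₀) ∧
        (∀ (y : Site 4) (τ i : Fin 4), l1 (y - x) ≤ 1 → ‖fd i (fun z => a z τ) y‖ ≤ α₁) ∧
        (∀ (τ i l : Fin 4), ‖fd i (fd l (fun z => a z τ)) x‖ ≤ α₂))
    (C : B11Thm1.Consts)
    (hR : ∀ (k : ℕ) (ε₁ : ℝ), 0 < ε₁ → ε₁ ≤ C.a₁ → ∀ (V U : Site 4 → Fin 4 → (MatA N)ˣ), V ∈ sfClass 4 F.L (ne3NperOfRecord₁₁ F 0 0) ε₁ 0 →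
      IsMinimiser 4 (sfClass 4 F.L (ne3NperOfRecord₁₁ F 0 0) (C.B₃ * ε₁)) F.L (ne3NperOfRecord₁₁ F 0 0) (k + 1) V U →
        ∀ x : Site 4, Regularity (torusVP 4 F.L (ne3NperOfRecord₁₁ F 0 0) G (k + 1)) C.B₃ C.B₄ ε₁ U (x, F.L ^ (k + 1) - 1 + F.L ^ (k + 1) + 2)) :
    ∃ ℓ : NE3Letters₁₁, ℓ.g = g ∧ ℓ.Λ₁ = radiusOfRecordH N F.L (ne3NperOfRecord₁₁ F 0 0) ∧ ℓ.C = constOfRecordH N F.L (ne3NperOfRecord₁₁ F 0 0) g ∧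
      0 < ℓ.b ∧ 512 * (4 + 1) * (4 + 4) * (F.L : ℝ) ^ 2 * ℓ.b ≤ 1 ∧ 0 < ℓ.Λ₂' ∧
      InEndRegimeH (ne3OfRecord₁₁ F
        { ne3ConstLayerOfRecord₁₁ F N ℓ with
          dom := {V | V ∈ ne3DomOfRecord₁₁ F N 0 0 ∧ V ∈ sfClass 4 F.L (ne3NperOfRecord₁₁ F 0 0) (ℓ.ε / C.B₃) 0} }) ∧
      LeafSlotHolderAT (ne3OfRecord₁₁ F
        { ne3ConstLayerOfRecord₁₁ F N ℓ with
          dom := {V | V ∈ ne3DomOfRecord₁₁ F N 0 0 ∧ V ∈ sfClass 4 F.L (ne3NperOfRecord₁₁ F 0 0) (ℓ.ε / C.B₃) 0} }) β :=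
  exists_letters_inEndRegimeH_leafSlotHolderAT_of_h5_reg910Slot F hg
    (h5_of_lettersB9Src_allTorusPinned (N := N) F.hL.2 β hlen hlen1 inp hB₀β hC₂eq hcB9 hB₀'H hB₂' hBG hBR hcL hc59 hγ₈ hγ' hB hB₀8 hγB
      hfreeS SLet SLetUB SB9P SH59src)
    hGm hG C hR

/-- **PER FAMILY, R-β (`0 ≤ β ≤ 1`): N16's NODE PREDICATE `N16HolderAt · β` AT THE LOOSE-DATA CARRIER FROM THE FOUR LETTERS AND THE SLOT KEY** — one application of
`N16H7LooseOfReg910SlotFamily.exists_letters_n16HolderAt_loose_of_h5_reg910Slot` at `h5 := h5_of_lettersB9Src_allTorusPinned …`. [cite: Balaban1985Variational, Thm 1 (9)–(10) p.279] [folklore] -/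
theorem exists_letters_n16HolderAt_loose_of_lettersB9Src_reg910Slot (hβ0 : 0 ≤ β) (hβ1 : β ≤ 1)
    {G : (Site 4 → Fin 4 → (MatA N)ˣ) → Site 4 → ℕ → ℝ → ℝ → ℝ → Prop} (hGm : RadiiMono 4 G)
    (hG : ∀ (U : Site 4 → Fin 4 → (MatA N)ˣ) (x : Site 4) (K : ℕ) (α₀ α₁ α₂ : ℝ), 2 ≤ K → G U x K α₀ α₁ α₂ →
      ∃ (u : Site 4 → (MatA N)ˣ) (a : Site 4 → Fin 4 → MatA N),
        (∀ z, u z ∈ unitaryUnits (MatA N)) ∧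
        (∀ (y : Site 4) (τ : Fin 4), l1 (y - x) ≤ 2 → ((gaugeAct u U y τ : (MatA N)ˣ) : MatA N) = exp (a y τ)) ∧
        (∀ (y : Site 4) (τ : Fin 4), l1 (y - x) ≤ 2 → ‖a y τ‖ ≤ α₀) ∧
        (∀ (y : Site 4) (τ i : Fin 4), l1 (y - x) ≤ 1 → ‖fd i (fun z => a z τ) y‖ ≤ α₁) ∧
        (∀ (τ i l : Fin 4), ‖fd i (fd l (fun z => a z τ)) x‖ ≤ α₂))
    (C : B11Thm1.Consts)
    (hR : ∀ (k : ℕ) (ε₁ : ℝ), 0 < ε₁ → ε₁ ≤ C.a₁ → ∀ (V U : Site 4 → Fin 4 → (MatA N)ˣ), V ∈ sfClass 4 F.L (ne3NperOfRecord₁₁ F 0 0) ε₁ 0 →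
      IsMinimiser 4 (sfClass 4 F.L (ne3NperOfRecord₁₁ F 0 0) (C.B₃ * ε₁)) F.L (ne3NperOfRecord₁₁ F 0 0) (k + 1) V U →
        ∀ x : Site 4, Regularity (torusVP 4 F.L (ne3NperOfRecord₁₁ F 0 0) G (k + 1)) C.B₃ C.B₄ ε₁ U (x, F.L ^ (k + 1) - 1 + F.L ^ (k + 1) + 2)) :
    ∃ ℓ : NE3Letters₁₁, ℓ.g = g ∧ ℓ.Λ₁ = radiusOfRecordH N F.L (ne3NperOfRecord₁₁ F 0 0) ∧ ℓ.C = constOfRecordH N F.L (ne3NperOfRecord₁₁ F 0 0) g ∧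
      0 < ℓ.b ∧ 512 * (4 + 1) * (4 + 4) * (F.L : ℝ) ^ 2 * ℓ.b ≤ 1 ∧ 0 < ℓ.Λ₂' ∧
      N16HolderAt (ne3OfRecord₁₁ F
        { ne3ConstLayerOfRecord₁₁ F N ℓ with
          dom := {V | V ∈ ne3DomOfRecord₁₁ F N 0 0 ∧ V ∈ sfClass 4 F.L (ne3NperOfRecord₁₁ F 0 0) (ℓ.ε / C.B₃) 0} }) β :=
  exists_letters_n16HolderAt_loose_of_h5_reg910Slot F hβ0 hβ1 hg
    (h5_of_lettersB9Src_allTorusPinned (N := N) F.hL.2 β hlen hlen1 inp hB₀β hC₂eq hcB9 hB₀'H hB₂' hBG hBR hcL hc59 hγ₈ hγ' hB hB₀8 hγB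
      hfreeS SLet SLetUB SB9P SH59src)
    hGm hG C hR

/-- ★ **PER FAMILY, R-β (`0 ≤ β ≤ 1`), THE (β16) LOOSE-AT ROAD OF RECORD AT THE SLOT KEY: N16's NODE PREDICATE (with the letter rows, `InEndRegimeH` and the leaf β-slot) AT ANY
LETTER-DEPENDENT SUB-DOMAIN `D ℓ` OF THE LOOSE `(ℓ.ε ∕ C.B₃)`-BALL, FROM THE FOUR LETTERS AND THE SLOT KEY** — `exists_letters_n16HolderAt_looseSub_of_lettersB9Src_thm1At`'s conclusion
VERBATIM (`D`, `hD` as there) with `(hGm, hG, C, hR)` for `(hGm, hG, C, hM, hT)`; one application of `N16H7LooseOfReg910SlotFamily.exists_letters_n16HolderAt_looseSub_of_h5_reg910Slot`.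
Under K3⁷ v5's loose pin family `F`'s N16 conjunct costs [4]'s four letters at the pinned members (N06) and (9)–(10) at the slot cubes of leaf-06's torus instances (N07).
[cite: Balaban1985Variational, Thm 1 (9)–(10) p.279; Balaban1985RegularSpaces, Thm 4 p.88, Prop. 3 p.87; Balaban1985BackgroundPropagators, Thm 3.3 p.398] [folklore] -/
theorem exists_letters_n16HolderAt_looseSub_of_lettersB9Src_reg910Slot (hβ0 : 0 ≤ β) (hβ1 : β ≤ 1)
    {G : (Site 4 → Fin 4 → (MatA N)ˣ) → Site 4 → ℕ → ℝ → ℝ → ℝ → Prop} (hGm : RadiiMono 4 G)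
    (hG : ∀ (U : Site 4 → Fin 4 → (MatA N)ˣ) (x : Site 4) (K : ℕ) (α₀ α₁ α₂ : ℝ), 2 ≤ K → G U x K α₀ α₁ α₂ →
      ∃ (u : Site 4 → (MatA N)ˣ) (a : Site 4 → Fin 4 → MatA N),
        (∀ z, u z ∈ unitaryUnits (MatA N)) ∧
        (∀ (y : Site 4) (τ : Fin 4), l1 (y - x) ≤ 2 → ((gaugeAct u U y τ : (MatA N)ˣ) : MatA N) = exp (a y τ)) ∧
        (∀ (y : Site 4) (τ : Fin 4), l1 (y - x) ≤ 2 → ‖a y τ‖ ≤ α₀) ∧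
        (∀ (y : Site 4) (τ i : Fin 4), l1 (y - x) ≤ 1 → ‖fd i (fun z => a z τ) y‖ ≤ α₁) ∧
        (∀ (τ i l : Fin 4), ‖fd i (fd l (fun z => a z τ)) x‖ ≤ α₂))
    (C : B11Thm1.Consts)
    (hR : ∀ (k : ℕ) (ε₁ : ℝ), 0 < ε₁ → ε₁ ≤ C.a₁ → ∀ (V U : Site 4 → Fin 4 → (MatA N)ˣ), V ∈ sfClass 4 F.L (ne3NperOfRecord₁₁ F 0 0) ε₁ 0 →
      IsMinimiser 4 (sfClass 4 F.L (ne3NperOfRecord₁₁ F 0 0) (C.B₃ * ε₁)) F.L (ne3NperOfRecord₁₁ F 0 0) (k + 1) V U →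
        ∀ x : Site 4, Regularity (torusVP 4 F.L (ne3NperOfRecord₁₁ F 0 0) G (k + 1)) C.B₃ C.B₄ ε₁ U (x, F.L ^ (k + 1) - 1 + F.L ^ (k + 1) + 2))
    (D : NE3Letters₁₁ → Set (Site 4 → Fin 4 → (MatA N)ˣ))
    (hD : ∀ ℓ : NE3Letters₁₁, D ℓ ⊆ {V | V ∈ ne3DomOfRecord₁₁ F N 0 0 ∧ V ∈ sfClass 4 F.L (ne3NperOfRecord₁₁ F 0 0) (ℓ.ε / C.B₃) 0}) :
    ∃ ℓ : NE3Letters₁₁, ℓ.g = g ∧ ℓ.Λ₁ = radiusOfRecordH N F.L (ne3NperOfRecord₁₁ F 0 0) ∧ ℓ.C = constOfRecordH N F.L (ne3NperOfRecord₁₁ F 0 0) g ∧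
      0 < ℓ.b ∧ 512 * (4 + 1) * (4 + 4) * (F.L : ℝ) ^ 2 * ℓ.b ≤ 1 ∧ 0 < ℓ.Λ₂' ∧
      InEndRegimeH (ne3OfRecord₁₁ F { ne3ConstLayerOfRecord₁₁ F N ℓ with dom := D ℓ }) ∧
      LeafSlotHolderAT (ne3OfRecord₁₁ F { ne3ConstLayerOfRecord₁₁ F N ℓ with dom := D ℓ }) β ∧
      N16HolderAt (ne3OfRecord₁₁ F { ne3ConstLayerOfRecord₁₁ F N ℓ with dom := D ℓ }) β :=
  exists_letters_n16HolderAt_looseSub_of_h5_reg910Slot F hβ0 hβ1 hg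
    (h5_of_lettersB9Src_allTorusPinned (N := N) F.hL.2 β hlen hlen1 inp hB₀β hC₂eq hcB9 hB₀'H hB₂' hBG hBR hcL hc59 hγ₈ hγ' hB hB₀8 hγB
      hfreeS SLet SLetUB SB9P SH59src)
    hGm hG C hR D hD

end PerFamily

end

end Summit.QuantumFields.YangMills.BalabanUVNodes.N16LettersOfLettersB9SrcAllTorusSlot
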